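import Summits.FinalStateConjecture.FinalStateConjecture.Theorems.PhotonSphereChannelsTameEternalLimitDefs
import Literature.Geometry.Lorentzian.SpacetimeLocalConvergenceChartTransport
import HarnessLib

/-!
# Crux `ChannelsResolveTameDevelopmentsR` (stmt-FinalStateConjecture-14075), line
# `trapped-set-observability-analyticity` — stub `stub_omegaLimits` (S1): the far-chart clause of
# `ArisesFrom` is automatic

Registered sub-goal `stub_arisesFromOfSubconverges` of the extraction stub S1 (`stub_omegaLimits`),
over the landed vocabulary `Theorems.TrappedSet` (`PhotonSphereChannelsTameEternalLimitDefs.lean`)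
and `Literature.Geometry.Lorentzian.SpacetimeLocalConvergence(ChartTransport)`.

`TameEternalLimit.ArisesFrom E 𝒟 p` asks for pointed `C²_loc` subconvergence of the constant
sequence `(𝒟, p n)` to `(E.Z, E.z)` TOGETHER WITH far charts `Φₙ` of `𝒟` converging through the
comparison maps to the eternal far chart `E.Φ` of the limit
(`Spacetime.SubconvergesLocallyWithFarChartsTo`, companion clause
`LocalSubconvergence.FarChartsConverge`). The far charts are existentially quantified and the
companion clause only constrains `Φₙ (sub n)` on compact parts of the far cylinder, eventually; so
one may TAKE `Φₙ (sub n) := embed n ∘ E.Φ` (junk off the convergence subsequence). Clause (i)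
(`embed n ∘ Φ = Φₙ (sub n)` eventually on compacts) then holds by construction, and clause (ii)
(`Cᵏ` convergence of the deviations `Φₙ^* gₙ − g₀ → Φ^* g − g₀` on compacts) is exactly the
chart-transport estimate `LocalSubconvergence.tendsto_supCkENorm_deviationExtend_comp_sub`
(`SpacetimeLocalConvergenceChartTransport.lean`: `Cᵏ` convergence of pulled-back components is
preserved under composition with a FIXED smooth chart map on compacts — chain rule with
`n`-independent `C^{k+1}` bounds of the transition maps), applied with `W = B.domain` and the
smooth far chart `E.Φ` (`E.isLocalDiffeomorph_far`).

* §1 (general: any sequence of spacetimes, any reference background `B`, any `k`):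
  `exists_dependent_extend` (re-indexing data given along an injective map);
  `exists_farChartsConverge` — along ANY subconvergence datum `D` there are far charts `Φₙ` of the
  members with `Φₙ (sub n) = embed n ∘ Φ` satisfying BOTH clauses of `FarChartsConverge`, for `Φ`
  smooth; hence `subconvergesLocallyWithFarChartsTo_of_subconvergesLocallyTo` and the equivalence
  `exists_subconvergesLocallyWithFarChartsTo_iff`: "subconvergence with SOME far charts of the
  members" ⇔ plain subconvergence.
* §2 (the line's vocabulary): `TameEternalLimit.arisesFrom_of_subconvergesLocallyTo`,
  `TameEternalLimit.arisesFrom_iff_subconvergesLocallyTo`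
  (`E.ArisesFrom 𝒟 p ↔ SubconvergesLocallyTo (fun _ ↦ 𝒟) p E.Z E.z 2`), and the registered
  closed form `stub_arisesFromOfSubconverges`. So S1 = "produce a `TameEternalLimit` to which the
  pointed developments `(𝒟, p n)` subconverge in `C²_loc`", nothing more.
-/

set_option linter.dupNamespace false

noncomputable section

namespace Summit.FinalStateConjecture.FinalStateConjecture.Theorems.TrappedSet

open Literature.Geometry.Lorentzian
open scoped Manifold ContDiff Topology ENNReal NNReal
open Filter Set Function TopologicalSpace

universe u v

/-! ## §1 Pushing a far chart of the limit through the comparison maps -/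

/-- **Dependent extension along an injective map.** Data `f i : F (σ i)` given along an
injective `σ : ι → κ` extend to a section `g : ∀ j, F j` with `g (σ i) = f i` (transport
`f i'` along `σ i' = j` for a chosen preimage `i'` — the transport is along `rfl` since `σ` is
injective — and use the default `d j` off the range). The dependent analogue of Mathlib's
`Function.extend` / `Injective.extend_apply`. [folklore] -/
theorem exists_dependent_extend {ι κ : Type*} {F : κ → Sort*} {σ : ι → κ} (hσ : Injective σ)
    (f : ∀ i, F (σ i)) (d : ∀ j, F j) : ∃ g : ∀ j, F j, ∀ i, g (σ i) = f i := by
  classical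
  have aux : ∀ {i i' : ι} (e : σ i' = σ i), cast (congrArg F e) (f i') = f i := fun e ↦ by
    obtain rfl := hσ e
    rfl
  refine ⟨fun j ↦ if h : ∃ i, σ i = j then cast (congrArg F h.choose_spec) (f h.choose) else d j,
    fun i ↦ ?_⟩
  have h : ∃ i', σ i' = σ i := ⟨i, rfl⟩
  simp only [dif_pos h]
  exact aux h.choose_spec

section FarCharts

variable {𝓢ₙ : ℕ → Spacetime.{u} 4} {pₙ : ∀ n, (𝓢ₙ n).carrier} {𝓢 : Spacetime.{v} 4}
  {p : 𝓢.carrier} {k : ℕ}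

/-- **The far-chart companion clause is automatic.** Let `D : (𝓢ₙ, pₙ) ⇀ (𝓢, p)` be a pointed
`Cᵏ_loc` subconvergence datum with comparison maps `φₙ = D.embed n : 𝓢 → 𝓢_{sub n}`, `B` a
reference background and `Φ : B.domain → 𝓢` a `C^∞` far chart of the LIMIT. Then there are far
charts `Φₙ` of the members — the PUSHED charts `Φ_{sub n} = φₙ ∘ Φ` along the convergence
subsequence (`exists_dependent_extend`; the constant junk chart `y ↦ pₙ m` at the other indices,
which the companion clause never looks at) — converging through the comparison maps to `Φ`
(`LocalSubconvergence.FarChartsConverge`): clause (i) by construction (for EVERY `n`), clause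
(ii) — `(φₙ ∘ Φ)^* gₙ − g₀ → Φ^* g − g₀` in `Cᵏ` on every compact `K ⊆ B.domain` — by the
chart-transport estimate `LocalSubconvergence.tendsto_supCkENorm_deviationExtend_comp_sub` with
`W = B.domain` (chain rule on compacts through the fixed smooth chart `Φ`; Petersen 2006, Ch. 10,
§3.2: push charts of the limit through the embeddings `Fᵢ`, convergence of components "is
clearly independent of the covering" by charts). [cite: Petersen2006, Ch. 10 §3.2] -/
theorem exists_farChartsConverge (D : Spacetime.LocalSubconvergence 𝓢ₙ pₙ 𝓢 p k)
    (B : ModelBackground) {Φ : B.domain → 𝓢.carrier} (hΦ : ContMDiff 𝓘(ℝ, E4) (𝓡 4) ∞ Φ) :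
    ∃ Φₙ : ∀ n, B.domain → (𝓢ₙ n).carrier,
      (∀ n, Φₙ (D.sub n) = D.embed n ∘ Φ) ∧ D.FarChartsConverge B Φₙ Φ := by
  obtain ⟨Φₙ, hsub⟩ := exists_dependent_extend (F := fun m ↦ B.domain → (𝓢ₙ m).carrier)
    D.strictMono_sub.injective (fun n ↦ D.embed n ∘ Φ) fun m _ ↦ pₙ m
  refine ⟨Φₙ, hsub, ?_, ?_⟩
  · intro K _ _
    exact Eventually.of_forall fun n y _ ↦ (congrFun (hsub n) y).symm
  · intro K hK hKB
    exact (D.tendsto_supCkENorm_deviationExtend_comp_sub B B.domain.isOpen Subset.rfl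
      hΦ.contMDiffOn hK hKB).congr fun n ↦ by rw [hsub n]

/-- **Plain subconvergence upgrades to subconvergence with far charts**, for every smooth far
chart `Φ` of the limit over every reference background `B` (`exists_farChartsConverge`).
[cite: Petersen2006, Ch. 10 §3.2] -/
theorem subconvergesLocallyWithFarChartsTo_of_subconvergesLocallyTo (B : ModelBackground)
    {Φ : B.domain → 𝓢.carrier} (hΦ : ContMDiff 𝓘(ℝ, E4) (𝓡 4) ∞ Φ)
    (h : Spacetime.SubconvergesLocallyTo 𝓢ₙ pₙ 𝓢 p k) :
    ∃ Φₙ : ∀ n, B.domain → (𝓢ₙ n).carrier,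
      Spacetime.SubconvergesLocallyWithFarChartsTo 𝓢ₙ pₙ 𝓢 p k B Φₙ Φ :=
  h.elim fun D ↦ (exists_farChartsConverge D B hΦ).imp fun _ hD ↦ ⟨D, hD.2⟩

/-- **Subconvergence with SOME far charts of the members ⇔ plain subconvergence**, for a smooth
far chart of the limit (`←`: pushed far charts; `→`: forget,
`SubconvergesLocallyWithFarChartsTo.subconvergesLocallyTo`). [folklore] -/
theorem exists_subconvergesLocallyWithFarChartsTo_iff (B : ModelBackground)
    {Φ : B.domain → 𝓢.carrier} (hΦ : ContMDiff 𝓘(ℝ, E4) (𝓡 4) ∞ Φ) :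
    (∃ Φₙ : ∀ n, B.domain → (𝓢ₙ n).carrier,
      Spacetime.SubconvergesLocallyWithFarChartsTo 𝓢ₙ pₙ 𝓢 p k B Φₙ Φ) ↔
      Spacetime.SubconvergesLocallyTo 𝓢ₙ pₙ 𝓢 p k :=
  ⟨fun ⟨_, h⟩ ↦ h.subconvergesLocallyTo,
    subconvergesLocallyWithFarChartsTo_of_subconvergesLocallyTo B hΦ⟩

end FarCharts

/-! ## §2 The line's vocabulary: `ArisesFrom ⇔ SubconvergesLocallyTo` -/

section Development

variable {X : Type} [TopologicalSpace X] [ChartedSpace Literature.Geometry.Lorentzian.E3 X]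
  [IsManifold (modelWithCornersSelf ℝ Literature.Geometry.Lorentzian.E3) ((⊤ : ℕ∞) : WithTop ℕ∞) X]
  [ConnectedSpace X]
  {D : Literature.Geometry.Lorentzian.InitialDataSet (modelWithCornersSelf ℝ Literature.Geometry.Lorentzian.E3) X}

/-- **The far-chart clause of `ArisesFrom` is automatic**: if the pointed developments
`(𝒟, p n)` subconverge in `C²_loc` to `(E.Z, E.z)`, the tame eternal limit `E` arises from `𝒟`
along `p` — with the far charts `φₙ ∘ E.Φ` pushed through the comparison maps (`E.Φ` is
smooth, `E.isLocalDiffeomorph_far`). [cite: Petersen2006, Ch. 10 §3.2] -/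
theorem TameEternalLimit.arisesFrom_of_subconvergesLocallyTo (E : TameEternalLimit)
    (𝒟 : VacuumCauchyDevelopment D) (p : ℕ → 𝒟.carrier)
    (h : Spacetime.SubconvergesLocallyTo (fun _ ↦ 𝒟.toSpacetime) p E.Z E.z 2) :
    E.ArisesFrom 𝒟 p :=
  subconvergesLocallyWithFarChartsTo_of_subconvergesLocallyTo (farBackground E.M E.R)
    E.isLocalDiffeomorph_far.contMDiff h

/-- **`ArisesFrom ⇔ SubconvergesLocallyTo`.** A tame eternal limit `E` arises from the
development `𝒟` along the base points `p` iff the pointed developments `(𝒟, p n)` subconverge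
to `(E.Z, E.z)` in the pointed `C²_loc` sense (`→`: forget the far charts; `←`:
`arisesFrom_of_subconvergesLocallyTo`). [folklore] -/
theorem TameEternalLimit.arisesFrom_iff_subconvergesLocallyTo (E : TameEternalLimit)
    (𝒟 : VacuumCauchyDevelopment D) (p : ℕ → 𝒟.carrier) :
    E.ArisesFrom 𝒟 p ↔ Spacetime.SubconvergesLocallyTo (fun _ ↦ 𝒟.toSpacetime) p E.Z E.z 2 :=
  ⟨fun ⟨_, h⟩ ↦ h.subconvergesLocallyTo, E.arisesFrom_of_subconvergesLocallyTo 𝒟 p⟩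

/-- Registered sub-goal `stub_arisesFromOfSubconverges` of `stub_omegaLimits` (S1): the
far-chart companion clause of `ArisesFrom` is automatic — plain pointed `C²_loc` subconvergence
of `(𝒟, p n)` to `(E.Z, E.z)` already gives `E.ArisesFrom 𝒟 p`. [folklore] -/
theorem stub_arisesFromOfSubconverges :
    ∀ (X : Type) [TopologicalSpace X] [ChartedSpace Literature.Geometry.Lorentzian.E3 X] [IsManifold (modelWithCornersSelf ℝ Literature.Geometry.Lorentzian.E3) ((⊤ : ℕ∞) : WithTop ℕ∞) X] [ConnectedSpace X] (D : Literature.Geometry.Lorentzian.InitialDataSet (modelWithCornersSelf ℝ Literature.Geometry.Lorentzian.E3) X) (𝒟 : Literature.Geometry.Lorentzian.VacuumCauchyDevelopment D) (p : ℕ → 𝒟.carrier) (E : TameEternalLimit), Literature.Geometry.Lorentzian.Spacetime.SubconvergesLocallyTo (fun _ ↦ 𝒟.toSpacetime) p E.Z E.z 2 → E.ArisesFrom 𝒟 p := by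
  intro X _ _ _ _ D 𝒟 p E h
  exact E.arisesFrom_of_subconvergesLocallyTo 𝒟 p h

end Development

end Summit.FinalStateConjecture.FinalStateConjecture.Theorems.TrappedSet

end
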